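import Summits.Ventures.HodgeRepro2.T5BergmanIntegrableCoeff

/-!
# The disc integrals `∫_𝔻 (1 - |z|²)^e dA`: finite iff `e > -1`

The analytic input of the integrability threshold of the discrete series (`T5BergmanIntegrableSharp`):
for a real exponent `e`,

  `∫_𝔻 (1 - |z|²)^e dA < ∞`  ⟺  `e > -1`.

In polar coordinates (`T5BergmanParseval.lintegral_ball_eq_polar`) this is the radial integral
`∫_0^1 r (1 - r²)^e dr`: finite for `e > -1` — for `e ≤ 0` the integrand is dominated by `(1 - r)^e`
(`1 - r ≤ 1 - r²`), integrable by Mathlib's `x^e` on `(0,1)` for `e > -1` reflected at `r ↦ 1 - r`; for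
`e ≥ 0` it is bounded by `1` (`integrableOn_radial_rpow`, `integrableOn_ball_rpow_of_neg_one_lt`) — and
at `e = -1` the integrand `r (1 - r²)^{-1} ≥ (4 (1 - r))^{-1}` on `(1/2, 1)` is NOT integrable
(`not_integrableOn_radial_inv`, Mathlib's `intervalIntegrable_inv_iff`; `not_integrableOn_ball_inv`).
Against the Poincaré measure `(1 - |z|²)^{-2} dA` of the disc: `(1 - |z|²)^{s/2}` is integrable for every
real `s > 2` (`integrable_rpow_poincare_of_two_lt`, generalising the natural exponents of
`T5BergmanIntegrableCoeff` / `T5BergmanIntegrableCoeffThree`) and `1 - |z|²` (the case `s = 2`) is not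
(`not_integrable_one_sub_poincare`).

Blind lane: Mathlib + the HodgeRepro2 prefix only; no sorry; axioms ⊆ {propext, Classical.choice,
Quot.sound}.
-/

namespace Summit.Ventures.HodgeRepro2.T5BergmanDiscThreshold

open MeasureTheory MeasureTheory.Measure Metric Filter Topology Set
open T5PoincareDensity T5PoincareMeasure T5SU11Unimodular T5SU11Fibration T5SU11FibrationHaar
  T5SU11FibrationCartan T5HaarCircle
open T5BergmanCoefficient T5BergmanPairing T5BergmanFourier T5BergmanParseval T5BergmanActStable
  T5BergmanMatrixCoeff T5BergmanSchur T5BergmanKTypeMatrix T5BergmanIntegrableCoeff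
open scoped Real ENNReal NNReal

/-- `1 - |z|² > 0` on the open disc. -/
lemma one_sub_sq_norm_pos {z : ℂ} (hz : z ∈ ball (0 : ℂ) 1) : 0 < 1 - ‖z‖ ^ 2 := by
  have := mem_ball_zero_iff.mp hz
  have h2 : ‖z‖ ^ 2 < 1 := by nlinarith [norm_nonneg z]
  linarith

/-! ### The radial integrals `∫_0^1 r (1 - r²)^e dr`: finite iff `e > -1` -/

/-- `(1 - r)^e` is integrable on `(0, 1)` for `e > -1` (Mathlib's `x^e` on `(0,1)`, reflected). -/
lemma integrableOn_one_sub_rpow_of_neg_one_lt {e : ℝ} (he : -1 < e) :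
    IntegrableOn (fun r : ℝ => (1 - r) ^ e) (Ioo (0 : ℝ) 1) := by
  have h1 : IntegrableOn (fun x : ℝ => x ^ e) (Ioo (0 : ℝ) 1) :=
    (intervalIntegral.integrableOn_Ioo_rpow_iff zero_lt_one).mpr he
  have h2 : IntervalIntegrable (fun x : ℝ => x ^ e) volume 0 1 :=
    (intervalIntegrable_iff_integrableOn_Ioo_of_le zero_le_one).mpr h1
  have h3 := (h2.comp_sub_left 1).symm
  simp only [sub_zero, sub_self] at h3
  exact (intervalIntegrable_iff_integrableOn_Ioo_of_le zero_le_one).mp h3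

/-- `r ↦ r (1 - r²)^e` is continuous on `(0, 1)`, hence a.e.-strongly measurable there. -/
lemma aestronglyMeasurable_radial_rpow (e : ℝ) :
    AEStronglyMeasurable (fun r : ℝ => r * (1 - r ^ 2) ^ e) (volume.restrict (Ioo (0 : ℝ) 1)) := by
  refine ContinuousOn.aestronglyMeasurable ?_ measurableSet_Ioo
  refine continuousOn_id.mul (ContinuousOn.rpow_const (by fun_prop) fun r hr => Or.inl ?_)
  obtain ⟨hr0, hr1⟩ := hr
  have : r ^ 2 < 1 := by nlinarith
  linarith

/-- **`r (1 - r²)^e` is integrable on `(0,1)` for every `e > -1`**: for `e ≤ 0` it is dominated by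
`(1 - r)^e` (`1 - r ≤ 1 - r²`), for `e ≥ 0` by `1`. -/
theorem integrableOn_radial_rpow {e : ℝ} (he : -1 < e) :
    IntegrableOn (fun r : ℝ => r * (1 - r ^ 2) ^ e) (Ioo (0 : ℝ) 1) := by
  rcases le_or_gt e 0 with he0 | he0
  · refine (integrableOn_one_sub_rpow_of_neg_one_lt he).mono' (aestronglyMeasurable_radial_rpow e) ?_
    rw [ae_restrict_iff' measurableSet_Ioo]
    refine Eventually.of_forall fun r hr => ?_
    obtain ⟨hr0, hr1⟩ := hr
    have hpos : 0 < 1 - r ^ 2 := by nlinarith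
    have hle : 1 - r ≤ 1 - r ^ 2 := by nlinarith
    have hnn : 0 ≤ r * (1 - r ^ 2) ^ e := mul_nonneg hr0.le (Real.rpow_nonneg hpos.le _)
    rw [Real.norm_eq_abs, abs_of_nonneg hnn]
    calc r * (1 - r ^ 2) ^ e ≤ 1 * (1 - r ^ 2) ^ e := by gcongr
      _ = (1 - r ^ 2) ^ e := one_mul _
      _ ≤ (1 - r) ^ e := Real.rpow_le_rpow_of_nonpos (by linarith) hle he0
  · have hvol : volume (Ioo (0 : ℝ) 1) ≠ ∞ := by
      rw [Real.volume_Ioo]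
      exact ENNReal.ofReal_ne_top
    refine (integrableOn_const (C := (1 : ℝ)) hvol).mono' (aestronglyMeasurable_radial_rpow e) ?_
    rw [ae_restrict_iff' measurableSet_Ioo]
    refine Eventually.of_forall fun r hr => ?_
    obtain ⟨hr0, hr1⟩ := hr
    have hpos : 0 < 1 - r ^ 2 := by nlinarith
    have hnn : 0 ≤ r * (1 - r ^ 2) ^ e := mul_nonneg hr0.le (Real.rpow_nonneg hpos.le _)
    rw [Real.norm_eq_abs, abs_of_nonneg hnn]
    calc r * (1 - r ^ 2) ^ e ≤ 1 * 1 := by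
          gcongr
          exact Real.rpow_le_one hpos.le (by nlinarith) he0.le
      _ = 1 := one_mul _

/-- **`∫_0^1 r (1 - r²)^{-1} dr = ∞`**: on `(1/2, 1)` the integrand dominates `(4 (1 - r))^{-1}`, and
`x⁻¹` is not integrable on `(0, 1/2)` (Mathlib's `intervalIntegrable_inv_iff`). -/
theorem not_integrableOn_radial_inv :
    ¬ IntegrableOn (fun r : ℝ => r * (1 - r ^ 2)⁻¹) (Ioo (0 : ℝ) 1) := by
  intro h
  have h1 : IntegrableOn (fun r : ℝ => r * (1 - r ^ 2)⁻¹) (Ioo (1 / 2 : ℝ) 1) :=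
    h.mono_set (Ioo_subset_Ioo (by norm_num) le_rfl)
  have h2 : IntegrableOn (fun r : ℝ => (1 - r)⁻¹) (Ioo (1 / 2 : ℝ) 1) := by
    refine (h1.const_mul 4).mono' ?_ ?_
    · refine ContinuousOn.aestronglyMeasurable ?_ measurableSet_Ioo
      refine ContinuousOn.inv₀ (by fun_prop) fun r hr => ?_
      obtain ⟨_, hr1⟩ := hr
      linarith
    · rw [ae_restrict_iff' measurableSet_Ioo]
      refine Eventually.of_forall fun r hr => ?_
      obtain ⟨hr0, hr1⟩ := hr
      have hpos : 0 < 1 - r := by linarith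
      have hpos2 : 0 < 1 - r ^ 2 := by nlinarith
      rw [Real.norm_eq_abs, abs_of_pos (inv_pos.mpr hpos)]
      have e : 4 * (r * (1 - r ^ 2)⁻¹) = (4 * r) / (1 - r ^ 2) := by ring
      rw [e, inv_eq_one_div, div_le_div_iff₀ hpos hpos2]
      nlinarith [mul_pos (by linarith : (0 : ℝ) < 3 * r - 1) hpos]
  have h3 : IntervalIntegrable (fun r : ℝ => (1 - r)⁻¹) volume (1 / 2) 1 :=
    (intervalIntegrable_iff_integrableOn_Ioo_of_le (by norm_num)).mpr h2
  have h4 := h3.comp_sub_left 1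
  simp only [sub_sub_cancel, sub_self] at h4
  rw [intervalIntegrable_inv_iff] at h4
  rcases h4 with h4 | h4
  · norm_num at h4
  · exact h4 (by norm_num [Set.mem_uIcc])

/-! ### The disc integrals `∫_𝔻 (1 - |z|²)^e dA`: finite iff `e > -1` -/

/-- **`(1 - |z|²)^e ∈ L¹(𝔻, dA)` for every `e > -1`** (polar coordinates). -/
theorem integrableOn_ball_rpow_of_neg_one_lt {e : ℝ} (he : -1 < e) :
    IntegrableOn (fun z : ℂ => (1 - ‖z‖ ^ 2) ^ e) (ball (0 : ℂ) 1) := by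
  set F : ℂ → ℝ := fun z => (1 - ‖z‖ ^ 2) ^ e with hF
  have hFc : ContinuousOn F (ball 0 1) :=
    ContinuousOn.rpow_const (by fun_prop) fun z hz => Or.inl (one_sub_sq_norm_pos hz).ne'
  refine ⟨hFc.aestronglyMeasurable measurableSet_ball, ?_⟩
  have hnn : 0 ≤ᵐ[volume.restrict (ball (0 : ℂ) 1)] F :=
    ae_restrict_of_forall_mem measurableSet_ball fun z hz =>
      Real.rpow_nonneg (one_sub_sq_norm_pos hz).le _
  rw [hasFiniteIntegral_iff_ofReal hnn, lintegral_ball_eq_polar F hFc]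
  have hin : ∀ r ∈ Ioo (0 : ℝ) 1, ∫⁻ θ in Ioo (-π) π, ENNReal.ofReal (r * F (circleMap 0 r θ)) =
      ENNReal.ofReal (r * (1 - r ^ 2) ^ e) * ENNReal.ofReal (2 * π) := by
    intro r hr
    have e' : ∀ θ : ℝ, F (circleMap 0 r θ) = (1 - r ^ 2) ^ e := by
      intro θ
      simp only [hF]
      rw [norm_circleMap_zero, sq_abs]
    simp_rw [e']
    rw [setLIntegral_const, Real.volume_Ioo]
    congr 2
    ring
  rw [setLIntegral_congr_fun measurableSet_Ioo hin, lintegral_mul_const' _ _ ENNReal.ofReal_ne_top]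
  refine ENNReal.mul_lt_top ?_ ENNReal.ofReal_lt_top
  have hrad := integrableOn_radial_rpow he
  have hnn' : 0 ≤ᵐ[volume.restrict (Ioo (0 : ℝ) 1)] fun r : ℝ => r * (1 - r ^ 2) ^ e := by
    refine ae_restrict_of_forall_mem measurableSet_Ioo fun r hr => ?_
    obtain ⟨hr0, hr1⟩ := hr
    have hpos : 0 < 1 - r ^ 2 := by nlinarith
    exact mul_nonneg hr0.le (Real.rpow_nonneg hpos.le _)
  exact (hasFiniteIntegral_iff_ofReal hnn').mp hrad.hasFiniteIntegral

/-- **`∫_𝔻 (1 - |z|²)^{-1} dA = ∞`** (polar coordinates and `not_integrableOn_radial_inv`). -/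
theorem not_integrableOn_ball_inv :
    ¬ IntegrableOn (fun z : ℂ => (1 - ‖z‖ ^ 2)⁻¹) (ball (0 : ℂ) 1) := by
  intro h
  apply not_integrableOn_radial_inv
  set F : ℂ → ℝ := fun z => (1 - ‖z‖ ^ 2)⁻¹ with hF
  have hFc : ContinuousOn F (ball 0 1) :=
    ContinuousOn.inv₀ (by fun_prop) fun z hz => (one_sub_sq_norm_pos hz).ne'
  have hnn : 0 ≤ᵐ[volume.restrict (ball (0 : ℂ) 1)] F :=
    ae_restrict_of_forall_mem measurableSet_ball fun z hz => inv_nonneg.mpr (one_sub_sq_norm_pos hz).le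
  have hfin := h.hasFiniteIntegral
  rw [hasFiniteIntegral_iff_ofReal hnn, lintegral_ball_eq_polar F hFc] at hfin
  have hin : ∀ r ∈ Ioo (0 : ℝ) 1, ∫⁻ θ in Ioo (-π) π, ENNReal.ofReal (r * F (circleMap 0 r θ)) =
      ENNReal.ofReal (r * (1 - r ^ 2)⁻¹) * ENNReal.ofReal (2 * π) := by
    intro r hr
    have e' : ∀ θ : ℝ, F (circleMap 0 r θ) = (1 - r ^ 2)⁻¹ := by
      intro θ
      simp only [hF]
      rw [norm_circleMap_zero, sq_abs]
    simp_rw [e']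
    rw [setLIntegral_const, Real.volume_Ioo]
    congr 2
    ring
  rw [setLIntegral_congr_fun measurableSet_Ioo hin, lintegral_mul_const' _ _ ENNReal.ofReal_ne_top]
    at hfin
  have hrad : ∫⁻ r in Ioo (0 : ℝ) 1, ENNReal.ofReal (r * (1 - r ^ 2)⁻¹) < ∞ :=
    ENNReal.lt_top_of_mul_ne_top_left hfin.ne (ENNReal.ofReal_pos.mpr (by positivity)).ne'
  have hmeas : AEStronglyMeasurable (fun r : ℝ => r * (1 - r ^ 2)⁻¹)
      (volume.restrict (Ioo (0 : ℝ) 1)) := by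
    refine ContinuousOn.aestronglyMeasurable ?_ measurableSet_Ioo
    refine continuousOn_id.mul (ContinuousOn.inv₀ (by fun_prop) fun r hr => ?_)
    obtain ⟨hr0, hr1⟩ := hr
    have : r ^ 2 < 1 := by nlinarith
    linarith
  refine ⟨hmeas, ?_⟩
  have hnn' : 0 ≤ᵐ[volume.restrict (Ioo (0 : ℝ) 1)] fun r : ℝ => r * (1 - r ^ 2)⁻¹ := by
    refine ae_restrict_of_forall_mem measurableSet_Ioo fun r hr => ?_
    obtain ⟨hr0, hr1⟩ := hr
    have hpos : 0 < 1 - r ^ 2 := by nlinarith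
    exact mul_nonneg hr0.le (inv_nonneg.mpr hpos.le)
  exact (hasFiniteIntegral_iff_ofReal hnn').mpr hrad

/-! ### Against the Poincaré measure -/

/-- `(1 - |z|²)^{s/2}` is `poincare`-integrable for every real `s > 2`. -/
lemma integrable_rpow_poincare_of_two_lt {s : ℝ} (hs : 2 < s) :
    Integrable (fun z : ℂ => (1 - ‖z‖ ^ 2) ^ (s / 2)) poincare := by
  have hd : Measurable fun z : ℂ => Real.toNNReal (dens z) := measurable_dens.real_toNNReal
  have e : poincare = (volume.restrict (ball 0 1)).withDensity
      fun z => ((Real.toNNReal (dens z) : ℝ≥0) : ℝ≥0∞) := rfl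
  rw [e, integrable_withDensity_iff_integrable_smul hd]
  refine (integrableOn_ball_rpow_of_neg_one_lt (e := s / 2 - 2) (by linarith)).congr_fun ?_
    measurableSet_ball
  intro z hz
  simp only
  rw [NNReal.smul_def, Real.coe_toNNReal _ (dens_nonneg z), smul_eq_mul, dens_eq_norm]
  have hpos := one_sub_sq_norm_pos hz
  have e2 : (1 - ‖z‖ ^ 2) ^ 2 = (1 - ‖z‖ ^ 2) ^ ((2 : ℕ) : ℝ) := (Real.rpow_natCast _ 2).symm
  rw [e2, one_div ((1 - ‖z‖ ^ 2) ^ ((2 : ℕ) : ℝ)), ← Real.rpow_neg hpos.le, ← Real.rpow_add hpos]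
  congr 1
  push_cast
  ring

/-- `1 - |z|²` is NOT `poincare`-integrable: `∫_𝔻 (1 - |z|²) (1 - |z|²)^{-2} dA = ∞`. -/
lemma not_integrable_one_sub_poincare :
    ¬ Integrable (fun z : ℂ => 1 - ‖z‖ ^ 2) poincare := by
  intro h
  apply not_integrableOn_ball_inv
  have hd : Measurable fun z : ℂ => Real.toNNReal (dens z) := measurable_dens.real_toNNReal
  have e : poincare = (volume.restrict (ball 0 1)).withDensity
      fun z => ((Real.toNNReal (dens z) : ℝ≥0) : ℝ≥0∞) := rfl
  rw [e, integrable_withDensity_iff_integrable_smul hd] at h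
  have h' : IntegrableOn (fun z : ℂ => (Real.toNNReal (dens z) : ℝ) • (1 - ‖z‖ ^ 2)) (ball 0 1) := h
  refine h'.congr_fun ?_ measurableSet_ball
  intro z hz
  simp only
  rw [smul_eq_mul, Real.coe_toNNReal _ (dens_nonneg z), dens_eq_norm]
  have hpos := one_sub_sq_norm_pos hz
  field_simp

end Summit.Ventures.HodgeRepro2.T5BergmanDiscThreshold
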